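import Summits.BirchSwinnertonDyer.BirchSwinnertonDyer.Theorems.ManinLocalTwoThreeEisensteinPhiFortyFour
import Summits.BirchSwinnertonDyer.BirchSwinnertonDyer.Theorems.ManinLocalTwoThreeEtaParity
import Summits.BirchSwinnertonDyer.BirchSwinnertonDyer.Theorems.ManinLocalTwoThreeEtaCertificateSparse
import Summits.BirchSwinnertonDyer.BirchSwinnertonDyer.Theorems.ManinLocalTwoThreeBracketSturm
import HarnessLib

/-!
# `η`-parity at level 44: the newform `Φ₄₄` is an EVEN-SUPPORTED `η`-combination, hence half-antiperiodic, hence `a₂ₖ(Φ₄₄) = 0`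

Cell `bsd-f2-manin`, route `ManinLocalTwoThree`, crux C2 `ManinOddAtFour` (stmt-BirchSwinnertonDyer-22967); prover seat p2 gen 31; `--supports`
(helper).  PURPOSE: the input `heven : ∀ n, 2 ∣ n → cuspCoeff φ n = 0` of desc's `χ₋₄`-squeeze transport
`TwistDefect.abs_maninConstant_eq_one_oneSeventySixC_of_cuspCoeff` (root `44a`, member `176c`) for a ROOT FORM `φ ∈ S₂(Γ₀(44))` with
`⇑φ = ⇑Φ₄₄` — DATUM-FREE (p1's `…_of_rootDatum` needs an `X₀(44)`-datum, i.e. modularity of `44a1`).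

THE IDENTITY (found by exact linear algebra over the eight even-supported holomorphic weight-2 `η`-quotients of level `44`, verified
to `q²²⁰`, proved here by Sturm at level `44`: bound `⌊2·72/12⌋ = 12`, thirteen coefficients):
`Φ₄₄ = −4·B1 + (3/2)·B2 − (4/11)·B4 − (3/22)·Z`, `B1 = η₄₄⁸/η₂₂⁴`, `B2 = η₄η₂₂⁷/(η₂η₄₄³)`, `B4 = η₄⁸/η₂⁴` (the tree's
`LevelFortyFour.B1/B2/B4`) and the NEW holomorphic quotient `Z = η₂⁷η₄₄/(η₄³η₂₂)` (`Z44`, Newman/Ligozat by `decide`, first thirteen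
coefficients by a sparse kernel `η`-certificate).  All four are supported on EVEN `δ` with half-shift exponent `Σ (δ/2)·r_δ ≡ 12 (mod 24)`,
so each satisfies `g(τ + ½) = −g(τ)` (`EtaParity.etaQuotient_half_vadd`); hence **`Φ₄₄(τ + ½) = −Φ₄₄(τ)`** (`Phi44_half_vadd`) and
**`a₂ₖ(φ) = 0` for every `φ ∈ S₂(Γ₀(44))` with `⇑φ = ⇑Φ₄₄`** (`cuspCoeff_eq_zero_phi44`, by `EtaParity.cuspCoeff_eq_zero_of_half_vadd_gamma0`);
also `φ ≠ 0` (`ne_zero_of_coe_eq_Phi44`, from `a₁ = 1`).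
HONEST FRAMING: unconditional, standard axioms; an identity in `M₂(Γ₀(44))` and its parity consequence — no Hecke theory; nothing here proves
C2, Manin's conjecture or BSD.
[cite: Ligozat1975, Ch. 3] [cite: Koehler2011, §2.1] [cite: Sturm1987, Thm. 1] [cite: CremonaAlgorithms1997, Table 3 (N = 44)]
-/

set_option autoImplicit false
-- lint-debt: the directory name repeats the summit name (sibling precedent `ManinLocalTwoThreeEtaParity.lean`)
set_option linter.dupNamespace false

noncomputable section

open Complex Filter Topology
open UpperHalfPlane hiding I
open scoped Real Topology Manifold MatrixGroups ModularForm
open ModularForm CongruenceSubgroup PowerSeries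
open Literature.NumberTheory.ModularForms
open Literature.NumberTheory.EllipticCurves Literature.NumberTheory.EllipticCurves.ModularForms

namespace Summit.BirchSwinnertonDyer.BirchSwinnertonDyer.Theorems.ManinLocalTwoThree.LevelFortyFour

open EtaParity BracketSturm PinningKernel

/-! ## §1 The fourth quotient `Z = η₂⁷η₄₄/(η₄³η₂₂) ∈ M₂(Γ₀(44))` -/

/-- The exponent vector of `Z = η₂⁷η₄₄/(η₄³η₂₂)`. [folklore] -/
def rZ44 : ℕ → ℤ := expFn [(2, 7), (4, -3), (22, -1), (44, 1)]

/-- Newman's conditions for `Z` in weight `2` (`∏ δ^|r_δ| = 2816²`). [cite: Ligozat1975, Ch. 3] -/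
theorem newman_Z44 : NewmanCond 44 rZ44 2 := ⟨by decide, by decide, by decide, ⟨2816, by decide⟩⟩

/-- Ligozat: the orders of `Z` at the six cusps of `Γ₀(44)` are `≥ 0`. [cite: Ligozat1975, Ch. 3] -/
theorem ord_Z44 : ∀ c ∈ (44 : ℕ).divisors, 0 ≤ cuspOrder24 44 rZ44 c := by decide

/-- **`Z ∈ M₂(Γ₀(44))`** (holomorphic `η`-quotient). [cite: Ligozat1975, Ch. 3] -/
def Z44 : ModularForm (Gamma0 44) 2 := etaQuotientModularForm 44 rZ44 2 (by decide) newman_Z44 ord_Z44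

/-- `Z(τ) = ∏ η(δτ)^{r_δ}` pointwise. [folklore] -/
theorem Z44_apply (τ : ℍ) : Z44 τ = etaQuotient 44 rZ44 τ := rfl

/-- The first thirteen `q`-coefficients of `Z`. [cite: Koehler2011, §2.1] -/
def tabZ44 : List ℤ := [0, 1, 0, -7, 0, 17, 0, -14, 0, 2, 0, -21, 0]

/-- `Σ δ·r_δ = 24` (order `1` at `∞`). [folklore] -/
theorem sum_rZ44 : ∑ δ ∈ (44 : ℕ).divisors, (δ : ℤ) * rZ44 δ = 24 * (1 : ℕ) := by decide

/-- Sparse kernel `η`-certificate of `Z` to depth `13`. [cite: Koehler2011, §2.1] -/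
theorem hcertZ44 : mulList 13 tabZ44 (etaDenListSparse 13 44 rZ44) = etaNumListSparse 13 44 rZ44 1 := by
  decide +kernel

/-- The coefficients `a₀, …, a₁₂` of `Z`. [cite: Koehler2011, §2.1] -/
theorem coeff_Z44 : ∀ n < 13, ((tabZ44.getD n 0 : ℤ) : ℂ) = (qExpansion 1 ⇑Z44).coeff n :=
  qExpansion_coeff_eq_of_etaCertificateSparse Z44 rZ44 Z44_apply 1 sum_rZ44 tabZ44 hcertZ44

/-! ## §2 The identity `Φ₄₄ = −4·B1 + (3/2)·B2 − (4/11)·B4 − (3/22)·Z` in `M₂(Γ₀(44))` (Sturm, thirteen coefficients) -/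

/-- **`Φ₄₄ = −4·B1 + (3/2)·B2 − (4/11)·B4 − (3/22)·Z`** in `M₂(Γ₀(44))`. [cite: Sturm1987, Thm. 1] [cite: CremonaAlgorithms1997, Table 3 (N = 44)] -/
theorem Phi44_eq_eta_comb :
    Phi44 = (-4 : ℂ) • B1 + (3 / 2 : ℂ) • B2 + (-(4 / 11) : ℂ) • B4 + (-(3 / 22) : ℂ) • Z44 := by
  rw [← sub_eq_zero]
  refine modularForm_eq_zero_of_coeff_eq_zero _ (m := 13) (fun i hi ↦ ?_) (by rw [gamma0_data_44.1]; decide)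
  have hZ := coeff_Z44 i hi
  have hi' : i ≤ 33 := by omega
  change modCoefₗ 44 2 i (Phi44 - ((-4 : ℂ) • B1 + (3 / 2 : ℂ) • B2 + (-(4 / 11) : ℂ) • B4 + (-(3 / 22) : ℂ) • Z44)) = 0
  rw [map_sub, map_add, map_add, map_add, map_smul, map_smul, map_smul, map_smul]
  change (qExpansion 1 ⇑Phi44).coeff i - ((-4 : ℂ) • (qExpansion 1 ⇑B1).coeff i + (3 / 2 : ℂ) • (qExpansion 1 ⇑B2).coeff i
    + (-(4 / 11) : ℂ) • (qExpansion 1 ⇑B4).coeff i + (-(3 / 22) : ℂ) • (qExpansion 1 ⇑Z44).coeff i) = 0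
  rw [coeff_Phi44 i hi', coeff_B1 i hi', coeff_B2 i hi', coeff_B4 i hi', ← hZ]
  simp only [tabZ44, smul_eq_mul]
  interval_cases i <;> norm_num

/-- The identity pointwise. [folklore] -/
theorem Phi44_apply_eq_eta_comb (τ : ℍ) :
    Phi44 τ = -4 * etaQuotient 44 rB1 τ + (3 / 2 : ℂ) * etaQuotient 44 rB2 τ - (4 / 11 : ℂ) * etaQuotient 44 rB4 τ
      - (3 / 22 : ℂ) * etaQuotient 44 rZ44 τ := by
  rw [Phi44_eq_eta_comb]
  simp only [ModularForm.add_apply, ModularForm.IsGLPos.smul_apply, smul_eq_mul]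
  rw [show (B1 : ℍ → ℂ) τ = etaQuotient 44 rB1 τ from rfl, show (B2 : ℍ → ℂ) τ = etaQuotient 44 rB2 τ from rfl,
    show (B4 : ℍ → ℂ) τ = etaQuotient 44 rB4 τ from rfl, Z44_apply]
  ring

/-! ## §3 Half-shift signs of the four even-supported quotients -/

/-- Half-shift exponent of `B1`: `Σ (δ/2)·r_δ = 132`. -/
theorem sum_half_B1 : (∑ δ ∈ (44 : ℕ).divisors, ((δ / 2 : ℕ) : ℤ) * rB1 δ) = 132 := by unfold rB1; decide
/-- Half-shift exponent of `B2`: `Σ (δ/2)·r_δ = 12`. -/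
theorem sum_half_B2 : (∑ δ ∈ (44 : ℕ).divisors, ((δ / 2 : ℕ) : ℤ) * rB2 δ) = 12 := by unfold rB2; decide
/-- Half-shift exponent of `B4`: `Σ (δ/2)·r_δ = 12`. -/
theorem sum_half_B4 : (∑ δ ∈ (44 : ℕ).divisors, ((δ / 2 : ℕ) : ℤ) * rB4 δ) = 12 := by unfold rB4; decide
/-- Half-shift exponent of `Z`: `Σ (δ/2)·r_δ = 12`. -/
theorem sum_half_Z44 : (∑ δ ∈ (44 : ℕ).divisors, ((δ / 2 : ℕ) : ℤ) * rZ44 δ) = 12 := by unfold rZ44; decide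

/-- `B1` is supported on even `δ`. -/
theorem support_even_B1 : ∀ δ ∈ (44 : ℕ).divisors, ¬ 2 ∣ δ → rB1 δ = 0 := by unfold rB1; decide
/-- `B2` is supported on even `δ`. -/
theorem support_even_B2 : ∀ δ ∈ (44 : ℕ).divisors, ¬ 2 ∣ δ → rB2 δ = 0 := by unfold rB2; decide
/-- `B4` is supported on even `δ`. -/
theorem support_even_B4 : ∀ δ ∈ (44 : ℕ).divisors, ¬ 2 ∣ δ → rB4 δ = 0 := by unfold rB4; decide
/-- `Z` is supported on even `δ`. -/
theorem support_even_Z44 : ∀ δ ∈ (44 : ℕ).divisors, ¬ 2 ∣ δ → rZ44 δ = 0 := by unfold rZ44; decide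

/-- `B1(τ + ½) = −B1(τ)`. [folklore] -/
theorem etaQuotient_B1_half_vadd (τ : ℍ) : etaQuotient 44 rB1 ((1 / 2 : ℝ) +ᵥ τ) = - etaQuotient 44 rB1 τ := by
  rw [etaQuotient_half_vadd 44 _ support_even_B1 τ, sum_half_B1, cexp_eq_neg_one_of_eq 132 5 (by norm_num), neg_one_mul]
/-- `B2(τ + ½) = −B2(τ)`. [folklore] -/
theorem etaQuotient_B2_half_vadd (τ : ℍ) : etaQuotient 44 rB2 ((1 / 2 : ℝ) +ᵥ τ) = - etaQuotient 44 rB2 τ := by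
  rw [etaQuotient_half_vadd 44 _ support_even_B2 τ, sum_half_B2, cexp_twelve, neg_one_mul]
/-- `B4(τ + ½) = −B4(τ)`. [folklore] -/
theorem etaQuotient_B4_half_vadd (τ : ℍ) : etaQuotient 44 rB4 ((1 / 2 : ℝ) +ᵥ τ) = - etaQuotient 44 rB4 τ := by
  rw [etaQuotient_half_vadd 44 _ support_even_B4 τ, sum_half_B4, cexp_twelve, neg_one_mul]
/-- `Z(τ + ½) = −Z(τ)`. [folklore] -/
theorem etaQuotient_Z44_half_vadd (τ : ℍ) : etaQuotient 44 rZ44 ((1 / 2 : ℝ) +ᵥ τ) = - etaQuotient 44 rZ44 τ := by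
  rw [etaQuotient_half_vadd 44 _ support_even_Z44 τ, sum_half_Z44, cexp_twelve, neg_one_mul]

/-! ## §4 `Φ₄₄` is half-antiperiodic; `a₂ₖ = 0` for every cusp form with underlying function `Φ₄₄` -/

/-- **`Φ₄₄(τ + ½) = −Φ₄₄(τ)`.** [folklore] -/
theorem Phi44_half_vadd (τ : ℍ) : Phi44 ((1 / 2 : ℝ) +ᵥ τ) = - Phi44 τ := by
  rw [Phi44_apply_eq_eta_comb, Phi44_apply_eq_eta_comb, etaQuotient_B1_half_vadd, etaQuotient_B2_half_vadd,
    etaQuotient_B4_half_vadd, etaQuotient_Z44_half_vadd]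
  ring

/-- **(I2) for `44a`, DATUM-FREE: `a₂ₖ(φ) = 0`** for every `φ ∈ S₂(Γ₀(44))` with `⇑φ = ⇑Φ₄₄`. [folklore] -/
theorem cuspCoeff_eq_zero_phi44 (φ : CuspForm (Gamma0 44) 2) (hφ : (⇑φ : ℍ → ℂ) = ⇑Phi44) (n : ℕ) (hn : 2 ∣ n) :
    cuspCoeff φ n = 0 := by
  refine cuspCoeff_eq_zero_of_half_vadd_gamma0 φ (fun τ ↦ ?_) n hn
  rw [show φ ((1 / 2 : ℝ) +ᵥ τ) = Phi44 ((1 / 2 : ℝ) +ᵥ τ) from congrFun hφ _, show φ τ = Phi44 τ from congrFun hφ τ,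
    Phi44_half_vadd]

/-- A cusp form with underlying function `Φ₄₄` is non-zero (`a₁(Φ₄₄) = 1`). [folklore] -/
theorem ne_zero_of_coe_eq_Phi44 (φ : CuspForm (Gamma0 44) 2) (hφ : (⇑φ : ℍ → ℂ) = ⇑Phi44) : φ ≠ 0 := by
  rintro rfl
  have h := coeff_Phi44 1 (by norm_num)
  rw [← hφ, CuspForm.coe_zero, UpperHalfPlane.qExpansion_zero, map_zero] at h
  norm_num at h

end Summit.BirchSwinnertonDyer.BirchSwinnertonDyer.Theorems.ManinLocalTwoThree.LevelFortyFour

end
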